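import Summits.AtomisticToContinuum.HydrodynamicLimit.Theorems.TwoClocksEquilibriumShearWindowLDStatic

/-!
# `EquilibriumShearWindowLD`: centring and the Jensen lower bound `Λ_τ(β) ≥ 0`
# (route TwoClocks, stmt-AtomisticToContinuum-14446; static sandwich, part 2 — lower side)

Companion of `TwoClocksEquilibriumShearWindowLDStatic.lean` (`--supports` stmt-AtomisticToContinuum-14446).
Under the constant-profile (global canonical) Gibbs law `G_N = localGibbsLaw σ a u θ N Φ`:

* `integrable_configEnergy_localGibbsLaw_const` — the kinetic energy is `G_N`-integrable
  (finite exponential moment, `lintegral_exp_mul_configEnergy_localGibbsLaw_le`);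
* `integral_window_integral_eq` — **centring identity** `∫ (∫₀ʷ F(Φ_r z i) dr) dG_N = w ∫ F(z i) dG_N`
  for continuous `F` of quadratic growth (Fubini through `aemeasurable_comp_flow_prod`, dominated by
  `C(1 + 2E(z))` on the good set, and stationarity `integral_comp_flow_localGibbsLaw_const`);
* `measurePreserving_velIsometry_localGibbsLaw_const` — the Gibbs law AT REST (`u = 0`) is invariant
  under `z ↦ ((xᵢ, R vᵢ))ᵢ` for every linear isometry `R` of `ℝ³` (twin of
  `measurePreserving_flipVel_localGibbsLaw`), whence `integral_shearStress_localGibbsLaw_const`: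
  the kinetic shear stress `φ(xᵢ) vᵢ⁰ vᵢ¹` is centred (reflection `v⁰ ↦ -v⁰`);
* `one_le_lintegral_exp_windowSum` — **Jensen**: for centred continuous `F` of quadratic growth, every
  flow, `β` and window `w > 0`, `1 ≤ ∫ exp(β ∑ᵢ w⁻¹∫₀ʷ F(Φ_r z i) dr) dG_N`;
* the item's instance `one_le_shearWindowMoment`: `1 ≤ M_N(β, τ)` for all `β`, `τ > 0`, `N`, `Φ` —
  the window pressure is `≥ 0`, so the item's "`≤ ε(N+1)` for every `ε > 0`" asserts exactly
  `inf_τ Λ_τ(β) = 0`; no negative rate is possible. (The assembled two-sided sandwich with the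
  explicit static constant is in part 4, `TwoClocksEquilibriumShearWindowLDSharp.lean`.)

References: S. Olla, S. R. S. Varadhan, H.-T. Yau, Comm. Math. Phys. 155 (1993) 523, §2;
H. Spohn, *Large Scale Dynamics of Interacting Particles* (1991), Part I §2.3.

prover-pitem-stmt-AtomisticToContinuum-14446-1.
-/

noncomputable section

open MeasureTheory Real Set
open scoped ENNReal

namespace Summit.AtomisticToContinuum.HydrodynamicLimit.Theorems

open Literature.Analysis.FluidPDE Literature.MathematicalPhysics.KineticTheory

/-! ### Centring: Gibbs means of window integrals (Fubini + stationarity) -/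

/-- **The kinetic energy is integrable under the constant-profile Gibbs law** (`a, θ > 0`,
`σ ≤ 1/2`): it has a finite exponential moment (`lintegral_exp_mul_configEnergy_localGibbsLaw_le`
at `γ = (4θ)⁻¹`) and `E ≤ γ⁻¹ e^{γE}`. [folklore] -/
theorem integrable_configEnergy_localGibbsLaw_const {a θ : ℝ} (ha : 0 < a) (hθ : 0 < θ) (u : V3)
    {σ : ℝ} (hσ2 : σ ≤ 1 / 2) (N : ℕ)
    (Φ : HardSphereFlow (Torus.geometry (Fin 3)) (hsDiameter σ N) (N + 1)) :
    Integrable (fun z : Config (N + 1) (Fin 3) T3 => configEnergy z)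
      (localGibbsLaw σ (fun _ => a) (fun _ => u) (fun _ => θ) N Φ) := by
  set μ := localGibbsLaw σ (fun _ => a) (fun _ => u) (fun _ => θ) N Φ with hμ
  set γ : ℝ := (4 * θ)⁻¹ with hγ
  have hγ0 : 0 < γ := by positivity
  have hγθ : 2 * γ * θ < 1 := by
    rw [hγ]
    field_simp
    norm_num
  have hexp := lintegral_exp_mul_configEnergy_localGibbsLaw_le (a₀ := fun _ => a) (θ₀ := fun _ => θ)
    (u₀ := fun _ => u) continuous_const continuous_const continuous_const (fun _ => ha)
    (fun _ => hθ) hσ2 N Φ hγ0.le (fun _ => le_rfl) (fun _ => le_rfl) hγθ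
  have hEm : Measurable fun z : Config (N + 1) (Fin 3) T3 => configEnergy z := by
    -- (as in `JParityClosureOddContactSymmetryCollisionWindowEvents.measurable_configEnergy_T3`)
    unfold configEnergy
    exact measurable_const.mul (Finset.measurable_sum _ fun i _ =>
      ((measurable_pi_apply i).snd.norm.pow_const 2))
  refine ⟨hEm.aestronglyMeasurable, ?_⟩
  -- `E ≤ γ⁻¹ exp(γ E)` pointwise
  have hpt : ∀ z : Config (N + 1) (Fin 3) T3,
      ‖configEnergy z‖ₑ ≤ ENNReal.ofReal γ⁻¹ * ENNReal.ofReal (Real.exp (γ * configEnergy z)) := by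
    intro z
    have hE0 : 0 ≤ configEnergy z := by unfold configEnergy; positivity
    rw [Real.enorm_eq_ofReal hE0, ← ENNReal.ofReal_mul (inv_nonneg.2 hγ0.le)]
    refine ENNReal.ofReal_le_ofReal ?_
    rw [inv_mul_eq_div, le_div_iff₀ hγ0]
    have := Real.add_one_le_exp (γ * configEnergy z)
    nlinarith
  rw [hasFiniteIntegral_iff_enorm]
  calc ∫⁻ z, ‖configEnergy z‖ₑ ∂μ
      ≤ ∫⁻ z, ENNReal.ofReal γ⁻¹ * ENNReal.ofReal (Real.exp (γ * configEnergy z)) ∂μ :=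
        lintegral_mono hpt
    _ = ENNReal.ofReal γ⁻¹ * ∫⁻ z, ENNReal.ofReal (Real.exp (γ * configEnergy z)) ∂μ :=
        lintegral_const_mul' _ _ ENNReal.ofReal_ne_top
    _ < ∞ := ENNReal.mul_lt_top ENNReal.ofReal_lt_top (hexp.trans_lt ENNReal.ofReal_lt_top)

/-- Along a good orbit, `|∫₀ʷ F(Φ_r z i) dr| ≤ w · C (1 + 2E(z))` for `|F(x,v)| ≤ C(1+‖v‖²)` and
`w ≥ 0` (energy conservation bounds every single speed by `√(2E(z))`). [folklore] -/
theorem abs_window_integral_le {ε : ℝ} {n : ℕ}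
    (Φ : HardSphereFlow (Torus.geometry (Fin 3)) ε n) {z : Config n (Fin 3) T3} (hz : z ∈ Φ.good)
    {F : T3 × V3 → ℝ} {C : ℝ} (hC : ∀ y, |F y| ≤ C * (1 + ‖y.2‖ ^ 2)) {w : ℝ} (hw : 0 ≤ w)
    (i : Fin n) :
    |∫ r in (0 : ℝ)..w, F (Φ.flow r z i)| ≤ w * (C * (1 + 2 * configEnergy z)) := by
  have hC0 : 0 ≤ C := growthConst_nonneg hC
  have hb : ∀ r ∈ Set.uIoc (0 : ℝ) w, ‖F (Φ.flow r z i)‖ ≤ C * (1 + 2 * configEnergy z) := by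
    intro r _
    rw [Real.norm_eq_abs]
    refine (hC _).trans (mul_le_mul_of_nonneg_left ?_ hC0)
    have := (norm_vel_sq_le_two_mul_configEnergy (Φ.flow r z) i).trans_eq
      (by rw [Φ.configEnergy_flow hz r])
    linarith
  have h := intervalIntegral.norm_integral_le_of_norm_le_const hb
  rw [Real.norm_eq_abs, sub_zero, abs_of_nonneg hw] at h
  exact h.trans_eq (by ring)

/-- **Gibbs mean of a window integral (Fubini + stationarity).** Under the constant-profile Gibbs law
`G_N` (`a, θ > 0`, `σ ≤ 1/2`), for continuous `F` of quadratic growth, every flow, every particle `i`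
and every `w ≥ 0`: `∫ (∫₀ʷ F(Φ_r z i) dr) dG_N = w ∫ F(z i) dG_N` — joint measurability of the flow
on its good set (`aemeasurable_comp_flow_prod`), domination by the integrable `C(1 + 2E(z))`,
Fubini, and `(Φ_r)_# G_N = G_N` (`integral_comp_flow_localGibbsLaw_const`). [folklore] -/
theorem integral_window_integral_eq {a θ : ℝ} (ha : 0 < a) (hθ : 0 < θ) (u : V3) {σ : ℝ}
    (hσ2 : σ ≤ 1 / 2) (N : ℕ)
    (Φ : HardSphereFlow (Torus.geometry (Fin 3)) (hsDiameter σ N) (N + 1))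
    {F : T3 × V3 → ℝ} (hF : Continuous F) {C : ℝ} (hC : ∀ y, |F y| ≤ C * (1 + ‖y.2‖ ^ 2))
    (i : Fin (N + 1)) {w : ℝ} (hw : 0 ≤ w) :
    ∫ z, (∫ r in (0 : ℝ)..w, F (Φ.flow r z i))
        ∂(localGibbsLaw σ (fun _ => a) (fun _ => u) (fun _ => θ) N Φ) =
      w * ∫ z, F (z i) ∂(localGibbsLaw σ (fun _ => a) (fun _ => u) (fun _ => θ) N Φ) := by
  set μ := localGibbsLaw σ (fun _ => a) (fun _ => u) (fun _ => θ) N Φ with hμ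
  haveI : IsProbabilityMeasure μ := isProbabilityMeasure_localGibbsLaw (a₀ := fun _ => a)
    (θ₀ := fun _ => θ) (u₀ := fun _ => u) continuous_const continuous_const continuous_const
    (fun _ => ha) (fun _ => hθ) hσ2 N Φ
  set ν : Measure ℝ := volume.restrict (Ioc (0 : ℝ) w) with hν
  haveI : IsFiniteMeasure ν := by
    rw [hν]
    exact isFiniteMeasure_restrict.2 (by simp)
  have hgood : μ Φ.goodᶜ = 0 :=
    (localGibbsLaw_absolutelyContinuous σ _ _ _ N Φ) Φ.measure_compl_good
  have hae : ∀ᵐ z ∂μ, z ∈ Φ.good :=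
    (measure_eq_zero_iff_ae_notMem.1 hgood).mono fun z hz => by simpa using hz
  have hFi : Measurable fun z : Config (N + 1) (Fin 3) T3 => F (z i) :=
    hF.measurable.comp (measurable_pi_apply i)
  -- integrability of the uncurried integrand on `μ × ν`: dominated by `C(1 + 2E(z))`
  have hm : AEStronglyMeasurable
      (Function.uncurry fun (z : Config (N + 1) (Fin 3) T3) (r : ℝ) => F (Φ.flow r z i)) (μ.prod ν) :=
    (aemeasurable_comp_flow_prod Φ hgood ν (0 : ℝ) hFi).aestronglyMeasurable
  have hdom : Integrable (fun p : Config (N + 1) (Fin 3) T3 × ℝ => C * (1 + 2 * configEnergy p.1))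
      (μ.prod ν) := by
    have h1 : Integrable (fun z : Config (N + 1) (Fin 3) T3 => C * (1 + 2 * configEnergy z)) μ :=
      ((integrable_const (1 : ℝ)).add
        ((integrable_configEnergy_localGibbsLaw_const ha hθ u hσ2 N Φ).const_mul 2)).const_mul C
    exact h1.comp_fst ν
  have haeP : ∀ᵐ p ∂(μ.prod ν), p.1 ∈ Φ.good :=
    (Measure.quasiMeasurePreserving_fst (μ := μ) (ν := ν)).ae hae
  have hint : Integrable
      (Function.uncurry fun (z : Config (N + 1) (Fin 3) T3) (r : ℝ) => F (Φ.flow r z i)) (μ.prod ν) := by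
    refine hdom.mono' hm ?_
    filter_upwards [haeP] with p hp
    have hC0 : 0 ≤ C := growthConst_nonneg hC
    change ‖F (Φ.flow p.2 p.1 i)‖ ≤ _
    rw [Real.norm_eq_abs]
    refine (hC _).trans (mul_le_mul_of_nonneg_left ?_ hC0)
    have := (norm_vel_sq_le_two_mul_configEnergy (Φ.flow p.2 p.1) i).trans_eq
      (by rw [Φ.configEnergy_flow hp p.2])
    linarith
  calc ∫ z, (∫ r in (0 : ℝ)..w, F (Φ.flow r z i)) ∂μ
      = ∫ z, (∫ r, F (Φ.flow r z i) ∂ν) ∂μ := by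
        simp_rw [intervalIntegral.integral_of_le hw, hν]
    _ = ∫ r, (∫ z, F (Φ.flow r z i) ∂μ) ∂ν := integral_integral_swap hint
    _ = ∫ _r, (∫ z, F (z i) ∂μ) ∂ν := by
        refine integral_congr_ae (ae_of_all _ fun r => ?_)
        exact integral_comp_flow_localGibbsLaw_const σ a θ u N Φ r hFi.aestronglyMeasurable
    _ = w * ∫ z, F (z i) ∂μ := by
        rw [hν, setIntegral_const, smul_eq_mul, Measure.real, Real.volume_Ioc, sub_zero,
          ENNReal.toReal_ofReal hw]

/-! ### Centring of the kinetic shear stress: a velocity reflection -/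

/-- The coordinatewise action `z ↦ ((xᵢ, R vᵢ))ᵢ` of a linear isometry `R` of velocity space is a
measurable embedding of phase space (a measurable equivalence with inverse given by `R⁻¹`).
[folklore] -/
theorem measurableEmbedding_velIsometry (n : ℕ) (R : V3 ≃ₗᵢ[ℝ] V3) :
    MeasurableEmbedding (fun z : Config n (Fin 3) T3 => fun i => ((z i).1, R (z i).2)) := by
  have hTm : Measurable (fun z : Config n (Fin 3) T3 => fun i => ((z i).1, R (z i).2)) :=
    measurable_pi_lambda _ fun i =>
      (measurable_pi_apply i).fst.prodMk (R.continuous.measurable.comp (measurable_pi_apply i).snd)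
  have hT'm : Measurable (fun z : Config n (Fin 3) T3 => fun i => ((z i).1, R.symm (z i).2)) :=
    measurable_pi_lambda _ fun i =>
      (measurable_pi_apply i).fst.prodMk
        (R.symm.continuous.measurable.comp (measurable_pi_apply i).snd)
  exact (⟨⟨fun z i => ((z i).1, R (z i).2), fun z i => ((z i).1, R.symm (z i).2),
    fun z => by funext i; simp, fun z => by funext i; simp⟩, hTm, hT'm⟩ :
    Config n (Fin 3) T3 ≃ᵐ Config n (Fin 3) T3).measurableEmbedding

/-- **The Gibbs law at rest is invariant under a linear isometry of every velocity.** For a linear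
isometry `R` of `ℝ³`, the map `z ↦ ((xᵢ, R vᵢ))ᵢ` preserves the constant-profile Gibbs law with
`u = 0`: it preserves Lebesgue measure (`LinearIsometryEquiv.measurePreserving`,
`volume_preserving_pi`) and the hard-sphere domain (positions are untouched), and the centred
Maxwellian is a function of the speed (`LinearIsometryEquiv.norm_map`). Twin of
`measurePreserving_flipVel_localGibbsLaw`. [folklore] -/
theorem measurePreserving_velIsometry_localGibbsLaw_const (σ a θ : ℝ) (N : ℕ)
    (Φ : HardSphereFlow (Torus.geometry (Fin 3)) (hsDiameter σ N) (N + 1)) (R : V3 ≃ₗᵢ[ℝ] V3) :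
    MeasurePreserving (fun z : Config (N + 1) (Fin 3) T3 => fun i => ((z i).1, R (z i).2))
      (localGibbsLaw σ (fun _ => a) (fun _ => 0) (fun _ => θ) N Φ)
      (localGibbsLaw σ (fun _ => a) (fun _ => 0) (fun _ => θ) N Φ) := by
  -- adapted from `measurePreserving_flipVel_localGibbsLaw` (HardSphereTwoTimePressure.lean)
  set T : Config (N + 1) (Fin 3) T3 → Config (N + 1) (Fin 3) T3 :=
    fun z i => ((z i).1, R (z i).2) with hT
  have hTe : MeasurableEmbedding T := measurableEmbedding_velIsometry (N + 1) R
  have hvol : MeasurePreserving T (volume : Measure (Config (N + 1) (Fin 3) T3)) volume := by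
    -- instance shortcut (the search for `SigmaFinite` on `𝕋³ × ℝ³` is deep)
    haveI hXE : SigmaFinite (volume : Measure (T3 × V3)) := inferInstance
    have h1 : MeasurePreserving (fun p : T3 × V3 => (p.1, R p.2)) volume volume :=
      (MeasurePreserving.id volume).prod R.measurePreserving
    exact volume_preserving_pi fun _ : Fin (N + 1) => h1
  -- `T` preserves the hard-sphere domain and hence the Liouville measure
  have hmemT : ∀ z : Config (N + 1) (Fin 3) T3,
      T z ∈ hardSphereDomain (Torus.geometry (Fin 3)) (N + 1) (hsDiameter σ N) ↔
        z ∈ hardSphereDomain (Torus.geometry (Fin 3)) (N + 1) (hsDiameter σ N) := by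
    intro z
    simp only [mem_hardSphereDomain, hT]
  have hdom : T ⁻¹' hardSphereDomain (Torus.geometry (Fin 3)) (N + 1) (hsDiameter σ N) =
      hardSphereDomain (Torus.geometry (Fin 3)) (N + 1) (hsDiameter σ N) := by
    ext z
    exact hmemT z
  have hS : MeasurePreserving T (liouville (Torus.geometry (Fin 3)) (N + 1) (hsDiameter σ N))
      (liouville (Torus.geometry (Fin 3)) (N + 1) (hsDiameter σ N)) := by
    have key := hvol.restrict_preimage_emb hTe
      (hardSphereDomain (Torus.geometry (Fin 3)) (N + 1) (hsDiameter σ N))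
    rw [hdom] at key
    simpa only [liouville_eq] using key
  -- the canonical density is `T`-invariant
  have hW : ∀ z : Config (N + 1) (Fin 3) T3,
      canonicalDensity (Torus.geometry (Fin 3)) (hsDiameter σ N) (N + 1)
          (localGibbsProfile (fun _ => a) (fun _ => (0 : V3)) (fun _ => θ)) (T z) =
        canonicalDensity (Torus.geometry (Fin 3)) (hsDiameter σ N) (N + 1)
          (localGibbsProfile (fun _ => a) (fun _ => (0 : V3)) (fun _ => θ)) z := by
    intro z
    have hTP : tensorPow (N + 1) (localGibbsProfile (fun _ => a) (fun _ => (0 : V3)) fun _ => θ)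
        (T z) = tensorPow (N + 1) (localGibbsProfile (fun _ => a) (fun _ => (0 : V3)) fun _ => θ) z := by
      simp only [tensorPow, hT, localGibbsProfile, localMaxwellian, sub_zero, LinearIsometryEquiv.norm_map]
    unfold canonicalDensity
    by_cases hz : z ∈ hardSphereDomain (Torus.geometry (Fin 3)) (N + 1) (hsDiameter σ N)
    · rw [Set.indicator_of_mem hz, Set.indicator_of_mem ((hmemT z).2 hz), hTP]
    · rw [Set.indicator_of_notMem hz, Set.indicator_of_notMem (fun h => hz ((hmemT z).1 h))]
  refine ⟨hTe.measurable, ?_⟩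
  ext A hA
  rw [Measure.map_apply hTe.measurable hA, localGibbsLaw, particleLaw_eq,
    withDensity_apply _ (hTe.measurable hA), withDensity_apply _ hA,
    ← lintegral_indicator (hTe.measurable hA), ← lintegral_indicator hA]
  conv_rhs => rw [← hS.lintegral_comp_emb hTe]
  refine lintegral_congr fun z => ?_
  by_cases hz : T z ∈ A
  · rw [Set.indicator_of_mem (show z ∈ T ⁻¹' A from hz), Set.indicator_of_mem hz]
    simp only [hW]
  · rw [Set.indicator_of_notMem (show z ∉ T ⁻¹' A from hz), Set.indicator_of_notMem hz]

/-- **The kinetic shear stress is centred under the Gibbs law at rest**: `∫ φ(xᵢ) vᵢ⁰ vᵢ¹ dG_N = 0`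
for every `φ` (the law is invariant under the reflection `v⁰ ↦ -v⁰` of every velocity, a coordinatewise
`LinearIsometryEquiv.piLpCongrRight`, under which the integrand is odd; no integrability is
needed). [folklore] -/
theorem integral_shearStress_localGibbsLaw_const (σ a θ : ℝ) (N : ℕ)
    (Φ : HardSphereFlow (Torus.geometry (Fin 3)) (hsDiameter σ N) (N + 1)) (φ : T3 → ℝ)
    (i : Fin (N + 1)) :
    ∫ z, φ (z i).1 * ((z i).2 0 * (z i).2 1)
      ∂(localGibbsLaw σ (fun _ => a) (fun _ => 0) (fun _ => θ) N Φ) = 0 := by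
  -- the reflection `v⁰ ↦ -v⁰` as a linear isometry of `ℝ³` (coordinatewise `neg`/`refl`)
  set R : V3 ≃ₗᵢ[ℝ] V3 := LinearIsometryEquiv.piLpCongrRight 2 fun i : Fin 3 =>
    if i = 0 then LinearIsometryEquiv.neg ℝ (E := ℝ) else LinearIsometryEquiv.refl ℝ ℝ with hRdef
  have hR : ∀ (v : V3) (i : Fin 3), R v i = if i = 0 then -v i else v i := by
    intro v i
    rw [hRdef, LinearIsometryEquiv.piLpCongrRight_apply, PiLp.toLp_apply]
    split_ifs <;> simp
  have hT := measurePreserving_velIsometry_localGibbsLaw_const σ a θ N Φ R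
  have hTe := measurableEmbedding_velIsometry (N + 1) R
  have h10 : (1 : Fin 3) ≠ 0 := by decide
  have h := hT.integral_comp hTe (fun z : Config (N + 1) (Fin 3) T3 => φ (z i).1 * ((z i).2 0 * (z i).2 1))
  have hodd : ∀ z : Config (N + 1) (Fin 3) T3,
      φ (z i).1 * ((R (z i).2) 0 * (R (z i).2) 1) = -(φ (z i).1 * ((z i).2 0 * (z i).2 1)) := by
    intro z
    rw [hR _ 0, hR _ 1, if_pos rfl, if_neg h10]
    ring
  simp only [hodd, integral_neg] at h
  linarith

/-! ### The lower bound: window exponential moments of centred observables are at least one -/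

/-- **Jensen: the window exponential moment of a centred observable is at least `1`.** Under the
constant-profile Gibbs law `G_N` (`a, θ > 0`, `σ ≤ 1/2`), for a continuous `F` of quadratic growth
whose one-body Gibbs means vanish (`∫ F(z i) dG_N = 0` for all `i`), every flow, `β` and `w > 0`:
`1 ≤ ∫ exp(β ∑ᵢ w⁻¹∫₀ʷ F(Φ_r z i) dr) dG_N`. The exponent is `G_N`-integrable (energy bound on the
good set + `integrable_configEnergy_localGibbsLaw_const`) with mean `0`
(`integral_window_integral_eq`), so Jensen for `exp` applies. In the items' currency: the window
pressure `Λ_τ(β) = limsup (N+1)⁻¹ log(…)` is `≥ 0`, and "`≤ ε` for every `ε > 0`" asserts exactly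
`Λ_τ(β) → 0`. [folklore] -/
theorem one_le_lintegral_exp_windowSum {a θ : ℝ} (ha : 0 < a) (hθ : 0 < θ) (u : V3) {σ : ℝ}
    (hσ2 : σ ≤ 1 / 2) (N : ℕ)
    (Φ : HardSphereFlow (Torus.geometry (Fin 3)) (hsDiameter σ N) (N + 1))
    {F : T3 × V3 → ℝ} (hF : Continuous F) (hFC : ∃ C : ℝ, ∀ y, |F y| ≤ C * (1 + ‖y.2‖ ^ 2))
    (hF0 : ∀ i, ∫ z, F (z i) ∂(localGibbsLaw σ (fun _ => a) (fun _ => u) (fun _ => θ) N Φ) = 0)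
    (β : ℝ) {w : ℝ} (hw : 0 < w) :
    1 ≤ ∫⁻ z, ENNReal.ofReal (Real.exp (β * ∑ i, w⁻¹ * ∫ r in (0 : ℝ)..w, F (Φ.flow r z i)))
        ∂(localGibbsLaw σ (fun _ => a) (fun _ => u) (fun _ => θ) N Φ) := by
  obtain ⟨C, hC⟩ := hFC
  set μ := localGibbsLaw σ (fun _ => a) (fun _ => u) (fun _ => θ) N Φ with hμ
  haveI : IsProbabilityMeasure μ := isProbabilityMeasure_localGibbsLaw (a₀ := fun _ => a)
    (θ₀ := fun _ => θ) (u₀ := fun _ => u) continuous_const continuous_const continuous_const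
    (fun _ => ha) (fun _ => hθ) hσ2 N Φ
  have hgood : μ Φ.goodᶜ = 0 :=
    (localGibbsLaw_absolutelyContinuous σ _ _ _ N Φ) Φ.measure_compl_good
  have hae : ∀ᵐ z ∂μ, z ∈ Φ.good :=
    (measure_eq_zero_iff_ae_notMem.1 hgood).mono fun z hz => by simpa using hz
  have hEi := integrable_configEnergy_localGibbsLaw_const ha hθ u hσ2 N Φ
  set X : Config (N + 1) (Fin 3) T3 → ℝ :=
    fun z => β * ∑ i, w⁻¹ * ∫ r in (0 : ℝ)..w, F (Φ.flow r z i) with hX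
  -- integrability of the exponent
  have hXi : Integrable X μ := by
    have hg : Integrable (fun z : Config (N + 1) (Fin 3) T3 =>
        |β| * (C * ((N + 1 : ℕ) : ℝ) + 2 * C * configEnergy z)) μ :=
      ((integrable_const (C * ((N + 1 : ℕ) : ℝ))).add (hEi.const_mul (2 * C))).const_mul |β|
    have hXm : AEMeasurable X μ := by
      refine AEMeasurable.const_mul (Finset.aemeasurable_fun_sum _ fun i _ => ?_) β
      exact (Φ.aemeasurable_intervalIntegral_comp_flow_torus
        (hF.measurable.comp (measurable_pi_apply i)) 0 w hgood).const_mul _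
    refine hg.mono' hXm.aestronglyMeasurable ?_
    filter_upwards [hae] with z hz
    rw [hX, Real.norm_eq_abs, abs_mul]
    exact mul_le_mul_of_nonneg_left (abs_sum_window_integral_le Φ hz hC hw) (abs_nonneg β)
  -- its mean vanishes
  have hterm : ∀ i, Integrable (fun z => w⁻¹ * ∫ r in (0 : ℝ)..w, F (Φ.flow r z i)) μ := by
    intro i
    refine Integrable.const_mul ?_ _
    have hg : Integrable (fun z : Config (N + 1) (Fin 3) T3 =>
        w * (C * (1 + 2 * configEnergy z))) μ :=
      (((integrable_const (1 : ℝ)).add (hEi.const_mul 2)).const_mul C).const_mul w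
    refine hg.mono' (Φ.aemeasurable_intervalIntegral_comp_flow_torus
        (hF.measurable.comp (measurable_pi_apply i)) 0 w hgood).aestronglyMeasurable ?_
    filter_upwards [hae] with z hz
    rw [Real.norm_eq_abs]
    exact abs_window_integral_le Φ hz hC hw.le i
  have hX0 : ∫ z, X z ∂μ = 0 := by
    rw [hX, integral_const_mul, integral_finsetSum _ fun i _ => hterm i]
    refine mul_eq_zero_of_right β (Finset.sum_eq_zero fun i _ => ?_)
    rw [integral_const_mul, integral_window_integral_eq ha hθ u hσ2 N Φ hF hC i hw.le, hF0 i]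
    ring
  -- Jensen
  have hJ := KineticFluxLdDecayTilt.ofReal_exp_integral_le_lintegral μ hXi
  rwa [hX0, Real.exp_zero, ENNReal.ofReal_one] at hJ

/-! ### The instance for the item -/

/-- **`Λ_τ(β) ≥ 0` for `EquilibriumShearWindowLD`** (stmt-AtomisticToContinuum-14446): for
`a₀, θ₀ > 0`, `σ ≤ 1/2`, every continuous `φ`, every `β`, `τ > 0`, `N` and every hard-sphere flow,
the item's window exponential moment is at least `1 = e^{0·(N+1)}` (the kinetic shear stress is
centred under the Gibbs law at rest, `integral_shearStress_localGibbsLaw_const`, and Jensen,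
`one_le_lintegral_exp_windowSum`). So the item's "`≤ exp(ε(N+1))` for every `ε > 0`" is the
assertion that the window pressure tends to ZERO as `τ → ∞`; no negative rate is possible.
[folklore] -/
theorem one_le_shearWindowMoment {a₀ θ₀ : ℝ} (ha : 0 < a₀) (hθ : 0 < θ₀) {σ : ℝ} (hσ2 : σ ≤ 1 / 2)
    (N : ℕ) (Φ : HardSphereFlow (Torus.geometry (Fin 3)) (hsDiameter σ N) (N + 1))
    {φ : T3 → ℝ} (hφ : Continuous φ) (β : ℝ) {τ : ℝ} (hτ : 0 < τ) :
    1 ≤ ∫⁻ z, ENNReal.ofReal (Real.exp (β * ∑ i : Fin (N + 1),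
        (τ * ((N : ℝ) + 1) ^ (-(1 / 3 : ℝ)))⁻¹ *
          ∫ r in (0 : ℝ)..(τ * ((N : ℝ) + 1) ^ (-(1 / 3 : ℝ))),
            φ (Φ.flow r z i).1 * ((Φ.flow r z i).2 0 * (Φ.flow r z i).2 1)))
        ∂(localGibbsLaw σ (fun _ => a₀) (fun _ => 0) (fun _ => θ₀) N Φ) := by
  have hw : 0 < τ * ((N : ℝ) + 1) ^ (-(1 / 3 : ℝ)) :=
    mul_pos hτ (Real.rpow_pos_of_pos (by positivity) _)
  have hF : Continuous fun y : T3 × V3 => φ y.1 * (y.2 0 * y.2 1) := by fun_prop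
  -- quadratic growth `|φ(x) v⁰ v¹| ≤ ‖φ‖_∞ (1 + |v|²)` (as in `exists_shear_growth_bound`)
  obtain ⟨C, hC⟩ : ∃ C : ℝ, ∀ y : T3 × V3, |φ y.1 * (y.2 0 * y.2 1)| ≤ C * (1 + ‖y.2‖ ^ 2) := by
    obtain ⟨C, hC⟩ := isCompact_univ.exists_bound_of_continuousOn (hφ.continuousOn (s := univ))
    refine ⟨C, fun y => ?_⟩
    have hφy : |φ y.1| ≤ C := by simpa [Real.norm_eq_abs] using hC y.1 (mem_univ _)
    have hC0 : 0 ≤ C := (abs_nonneg _).trans hφy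
    have h0 : |y.2 0| ≤ ‖y.2‖ := by simpa [Real.norm_eq_abs] using PiLp.norm_apply_le y.2 0
    have h1 : |y.2 1| ≤ ‖y.2‖ := by simpa [Real.norm_eq_abs] using PiLp.norm_apply_le y.2 1
    have hv : |y.2 0 * y.2 1| ≤ 1 + ‖y.2‖ ^ 2 := by
      rw [abs_mul]
      nlinarith [abs_nonneg (y.2 0), abs_nonneg (y.2 1), norm_nonneg y.2]
    rw [abs_mul]
    exact mul_le_mul hφy hv (abs_nonneg _) hC0
  exact one_le_lintegral_exp_windowSum ha hθ 0 hσ2 N Φ hF ⟨C, hC⟩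
    (fun i => integral_shearStress_localGibbsLaw_const σ a₀ θ₀ N Φ φ i) β hw

end Summit.AtomisticToContinuum.HydrodynamicLimit.Theorems

end
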